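import Literature.NumberTheory.EllipticCurves.Curve15A1Descent
import HarnessLib

/-!
# Route `Langlands/SqrtFiveQuarticCovers` — the `2`-descent on the twist of `X₀(21)` by `5`,
# arithmetic core: square classes of `x + 5` and `x − 40` on
# `T₅₂₅ : y² = x³ + 5x² − 1600x − 8000 = (x + 5)(x − 40)(x + 40)`

Cell lg-quartmod (F-L1), seat eng-8 g4 (helper of stmt-Langlands-23416; companion of
`…Rank0TwentyOneTwist525.lean`, which turns this core into `Twist525.finite_point`, and of
`…Rank0TwentyOneSqrtFive.lean`).  `T₅₂₅ = ⟨0, 5, 0, -1600, -8000⟩ = (2, 0, 0, 0) • (X₀(21)).quadraticTwist 5`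
(`X₀(21) = 21A1 = [1, 0, 0, -4, -1]`, split model `Y² = (X + 1)(X − 8)(X + 8)` of the tree's
`Curve21A1Descent.lean`; twist `5Y² = …`, rescale by `5`: roots `−5, 40, −40`), conductor
`525 = 3·5²·7`, the quadratic twist `21a1 ⊗ χ₅`.  The lineage E10X of sheet 4.5 (eng-1 g3,
E10X-REPORT 21347fd33ceba04b) NAMES «rank `0` of `21a1` and of `21a1 ⊗ χ₅` over `ℚ`»
(Kolyvagin–Logachev from `L(21a,1)·L(21a⊗χ₅,1) ≠ 0`); the tree PROVES the first
(`Curve21A1.finite_point`); this file and its companion prove the second.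

METHOD (the tree's `Curve15A1Descent.lean` / `…Rank0FifteenTwist75.lean` VERBATIM; Silverman *AEC*
Prop. X.1.4 / Example X.1.5, `S = {2, 3, 5, 7, ∞}`), components `(x + 5, x − 40)`.  For a rational
point with `y ≠ 0`: `ord_p(x + 5)` is even for `p ∉ {3, 5, 7}` (root differences `45`, `35`),
`ord_p(x − 40)` is even for `p ∉ {2, 3, 5}` (`45`, `80`), `ord_3(x + 40)` is even (`35`, `80`), hence
`ord_3(x + 5) ≡ ord_3(x − 40) (mod 2)` (`Curve24A1.even_padicValRat_sub`).  ODD `ord_3`: then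
`|x + 5| ∈ {3, 15, 21, 105}·u²` (`Curve15A1.exists_abs_eq_sq_or₂` applied to `(x + 5)/3`) and all
eight signed classes die by a congruence (`Curve15A1.not_sq_of_quartic`, a `decide` over `ZMod 16`
or `ZMod 9` each: `even_padicValRat_three`).  EVEN `ord_3`: `|x + 5| ∈ {1, 5, 7, 35}·u²`,
`|x − 40| ∈ {1, 2, 5, 10}·w²`, `x + 5` and `x − 40` have the same sign and `x + 40 > 0` (`y² > 0`);
ten more congruences (`ZMod 16`, `ZMod 7`) exclude `x + 5 ∈ {7, 35, −1, −5}·u²` and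
`x − 40 ∈ {2, 5, 10, −1, −2, −10}·w²`, leaving `(x + 5, x − 40) ∈ {(u², w²), (5u², w²),
(−7u², −5w²), (−35u², −5w²)}` (`exists_sq_of_sq_eq`) — the classes of `O, (40, 0), (−5, 0), (−40, 0)`.
Obstruction moduli and presentations were chosen by `code/e21/hcrit525b.py` (HOME/lg-quartmod-eng-8/g4/);
sharpness (no further classes locally soluble) by `code/e21/scope525.py`.

HONEST STATUS: elementary arithmetic of ONE explicit elliptic curve over `ℚ` (conductor `525`);
not a BSD or modularity statement; closes no binder of the route's Record (it discharges a NAMED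
rank-`0` input used inside one lineage document of sheet 4.5); nothing here proves modularity of a new
class of elliptic curves.  References: [SilvermanAEC2009] Prop. X.1.4, Example X.1.5, X.4.9;
[CremonaAlgorithms1997] Table 1 (`N = 21`) and §3.6.
-/

noncomputable section

set_option linter.dupNamespace false -- project-wide option; `Summit.Langlands.Langlands` is the mandated namespace

namespace Summit.Langlands.Langlands.Theorems.SqrtFiveQuarticCovers

namespace Twist525

open Literature.NumberTheory.EllipticCurves Literature.NumberTheory.EllipticCurves.Curve24A1
  Literature.NumberTheory.EllipticCurves.Curve15A1

/-! ### Squares modulo `16`, `9`, `7` -/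

/-- The squares modulo `16` are `0, 1, 4, 9`. [folklore] -/
theorem sq_mem_mod16 : ∀ z : ZMod 16, z ^ 2 ∈ ({0, 1, 4, 9} : Finset (ZMod 16)) := by decide

/-- The squares modulo `9` are `0, 1, 4, 7`. [folklore] -/
theorem sq_mem_mod9 : ∀ z : ZMod 9, z ^ 2 ∈ ({0, 1, 4, 7} : Finset (ZMod 9)) := by decide

/-- The squares modulo `7` are `0, 1, 2, 4`. [folklore] -/
theorem sq_mem_mod7 : ∀ z : ZMod 7, z ^ 2 ∈ ({0, 1, 2, 4} : Finset (ZMod 7)) := by decide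

/-! ### Valuations of the three factors -/

/-- **Parities of the valuations of `x + 5`, `x − 40`, `x + 40` on `T₅₂₅`** (Silverman, *AEC*,
Example X.1.5, first step, via the tree's `Curve24A1.even_padicValRat_sub`): for a rational point
with `y ≠ 0` the three factors are non-zero, `ord_p(x + 5)` is even for `p ∉ {3, 5, 7}`,
`ord_p(x − 40)` is even for `p ∉ {2, 3, 5}`, and `ord_3(x + 5) ≡ ord_3(x − 40) (mod 2)` (because
`ord_3(x + 40)` is even and the three valuations sum to `2 ord_3 y`). [cite: SilvermanAEC2009, Example X.1.5 (method)] -/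
theorem parities {x y : ℚ} (hy : y ≠ 0) (h : y ^ 2 = x ^ 3 + 5 * x ^ 2 - 1600 * x - 8000) :
    x + 5 ≠ 0 ∧ x - 40 ≠ 0 ∧ x + 40 ≠ 0 ∧
      (∀ p : ℕ, p.Prime → p ≠ 3 → p ≠ 5 → p ≠ 7 → Even (padicValRat p (x + 5))) ∧
      (∀ p : ℕ, p.Prime → p ≠ 2 → p ≠ 3 → p ≠ 5 → Even (padicValRat p (x - 40))) ∧
      (Even (padicValRat 3 (x + 5)) ↔ Even (padicValRat 3 (x - 40))) := by
  have hfac : y ^ 2 = (x + 5) * (x - 40) * (x + 40) := by rw [h]; ring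
  have h₀ : (x + 5) * (x - 40) * (x + 40) ≠ 0 := hfac ▸ pow_ne_zero 2 hy
  have hx₁ : x + 5 ≠ 0 := fun h0 => h₀ (by rw [h0, zero_mul, zero_mul])
  have hx₂ : x - 40 ≠ 0 := fun h0 => h₀ (by rw [h0, mul_zero, zero_mul])
  have hx₃ : x + 40 ≠ 0 := fun h0 => h₀ (by rw [h0, mul_zero])
  haveI : Fact (Nat.Prime 5) := ⟨Nat.prime_five⟩
  haveI : Fact (Nat.Prime 7) := ⟨by decide⟩
  haveI : Fact (Nat.Prime 3) := ⟨Nat.prime_three⟩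
  haveI : Fact (Nat.Prime 2) := ⟨Nat.prime_two⟩
  have P₁ : ∀ p : ℕ, p.Prime → p ≠ 3 → p ≠ 5 → p ≠ 7 → Even (padicValRat p (x + 5)) := by
    intro p hp hp3 hp5 hp7
    haveI := Fact.mk hp
    have key := even_padicValRat_sub p (e₁ := -5) (e₂ := 40) (e₃ := -40) (x := x)
      (by norm_num) (by norm_num) ?_ ?_ hy (by rw [h]; ring)
    · rwa [sub_neg_eq_add] at key
    · rw [show (-5 : ℚ) - 40 = -(((3 : ℕ) : ℚ) ^ 2 * ((5 : ℕ) : ℚ)) by norm_num, padicValRat.neg,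
        padicValRat.mul (by norm_num) (by norm_num), padicValRat.pow, padicValRat.of_nat,
        padicValRat.of_nat, padicValNat_primes hp3, padicValNat_primes hp5, Nat.cast_zero, mul_zero,
        add_zero]
    · rw [show (-5 : ℚ) - (-40) = ((5 : ℕ) : ℚ) * ((7 : ℕ) : ℚ) by norm_num,
        padicValRat.mul (by norm_num) (by norm_num), padicValRat.of_nat, padicValRat.of_nat,
        padicValNat_primes hp5, padicValNat_primes hp7, Nat.cast_zero, add_zero]
  have P₂ : ∀ p : ℕ, p.Prime → p ≠ 2 → p ≠ 3 → p ≠ 5 → Even (padicValRat p (x - 40)) := by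
    intro p hp hp2 hp3 hp5
    haveI := Fact.mk hp
    refine even_padicValRat_sub p (e₁ := 40) (e₂ := -5) (e₃ := -40) (x := x)
      (by norm_num) (by norm_num) ?_ ?_ hy (by rw [h]; ring)
    · rw [show (40 : ℚ) - (-5) = ((3 : ℕ) : ℚ) ^ 2 * ((5 : ℕ) : ℚ) by norm_num,
        padicValRat.mul (by norm_num) (by norm_num), padicValRat.pow, padicValRat.of_nat,
        padicValRat.of_nat, padicValNat_primes hp3, padicValNat_primes hp5, Nat.cast_zero, mul_zero,
        add_zero]
    · rw [show (40 : ℚ) - (-40) = ((2 : ℕ) : ℚ) ^ 4 * ((5 : ℕ) : ℚ) by norm_num,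
        padicValRat.mul (by norm_num) (by norm_num), padicValRat.pow, padicValRat.of_nat,
        padicValRat.of_nat, padicValNat_primes hp2, padicValNat_primes hp5, Nat.cast_zero, mul_zero,
        add_zero]
  have P₃ : Even (padicValRat 3 (x + 40)) := by
    have key := even_padicValRat_sub 3 (e₁ := -40) (e₂ := -5) (e₃ := 40) (x := x)
      (by norm_num) (by norm_num) ?_ ?_ hy (by rw [h]; ring)
    · rwa [sub_neg_eq_add] at key
    · rw [show (-40 : ℚ) - (-5) = -(((5 : ℕ) : ℚ) * ((7 : ℕ) : ℚ)) by norm_num, padicValRat.neg,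
        padicValRat.mul (by norm_num) (by norm_num), padicValRat.of_nat, padicValRat.of_nat,
        padicValNat_primes (show (3 : ℕ) ≠ 5 by norm_num),
        padicValNat_primes (show (3 : ℕ) ≠ 7 by norm_num), Nat.cast_zero, add_zero]
    · rw [show (-40 : ℚ) - 40 = -(((2 : ℕ) : ℚ) ^ 4 * ((5 : ℕ) : ℚ)) by norm_num, padicValRat.neg,
        padicValRat.mul (by norm_num) (by norm_num), padicValRat.pow, padicValRat.of_nat,
        padicValRat.of_nat, padicValNat_primes (show (3 : ℕ) ≠ 2 by norm_num),
        padicValNat_primes (show (3 : ℕ) ≠ 5 by norm_num), Nat.cast_zero, mul_zero, add_zero]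
  have hsum : 2 * padicValRat 3 y =
      padicValRat 3 (x + 5) + padicValRat 3 (x - 40) + padicValRat 3 (x + 40) := by
    have key := congrArg (padicValRat 3) hfac
    rw [padicValRat.pow, padicValRat.mul (mul_ne_zero hx₁ hx₂) hx₃, padicValRat.mul hx₁ hx₂] at key
    exact_mod_cast key
  have hlink : Even (padicValRat 3 (x + 5) + padicValRat 3 (x - 40)) := by
    obtain ⟨k, hk⟩ := P₃
    exact ⟨padicValRat 3 y - k, by omega⟩
  exact ⟨hx₁, hx₂, hx₃, P₁, P₂, Int.even_add.mp hlink⟩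

/-! ### Odd `ord_3`: no rational point -/

/-- **The classes `x + 5 ∈ {±3, ±15, ±21, ±105}·u²` are empty**: on `T₅₂₅`, `ord_3(x + 5)` is EVEN
for every rational point with `y ≠ 0`.  If it were odd, `|x + 5|/3 ∈ {1, 5, 7, 35}·u²`
(`exists_abs_eq_sq_or₂`), and each of the eight signed classes gives a rational point on a quartic
`W² = (αu² + β)(γu² + δ)` with no rational point by a congruence modulo `16` or `9`
(`not_sq_of_quartic`; e.g. `x + 5 = −3u²`: `(y/(3u))² = (u² + 15)(35 − 3u²)`, insoluble mod `9`).
[cite: SilvermanAEC2009, Example X.1.5 and X.4.9 (method)] -/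
theorem even_padicValRat_three {x y : ℚ} (hy : y ≠ 0)
    (h : y ^ 2 = x ^ 3 + 5 * x ^ 2 - 1600 * x - 8000) : Even (padicValRat 3 (x + 5)) := by
  obtain ⟨hx₁, -, -, P₁, -, -⟩ := parities hy h
  haveI : Fact (Nat.Prime 5) := ⟨Nat.prime_five⟩
  haveI : Fact (Nat.Prime 7) := ⟨by decide⟩
  haveI : Fact (Nat.Prime 3) := ⟨Nat.prime_three⟩
  by_contra hodd
  -- `(x + 5)/3` has even valuations away from `5, 7`
  have h3 : (3 : ℚ) ≠ 0 := by norm_num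
  have hr : (x + 5) / 3 ≠ 0 := div_ne_zero hx₁ h3
  have hP : ∀ p : ℕ, p.Prime → p ≠ 5 → p ≠ 7 → Even (padicValRat p ((x + 5) / 3)) := by
    intro p hp hp5 hp7
    haveI := Fact.mk hp
    rw [padicValRat.div hx₁ h3, show (3 : ℚ) = ((3 : ℕ) : ℚ) by norm_num, padicValRat.of_nat]
    by_cases hp3 : p = 3
    · subst hp3
      rw [padicValNat_self, Nat.cast_one]
      rw [Int.not_even_iff_odd] at hodd
      obtain ⟨k, hk⟩ := hodd
      exact ⟨k, by omega⟩
    · rw [padicValNat_primes hp3, Nat.cast_zero, sub_zero]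
      exact P₁ p hp hp3 hp5 hp7
  obtain ⟨u, hu⟩ := exists_abs_eq_sq_or₂ hr 5 7 hP
  push_cast at hu
  rw [abs_div, abs_of_pos (show (0 : ℚ) < 3 by norm_num)] at hu
  have hu0 : u ≠ 0 := by
    rintro rfl
    have h0 : |x + 5| / 3 = 0 := by rcases hu with hu | hu | hu | hu <;> rw [hu] <;> ring
    rcases div_eq_zero_iff.mp h0 with h0 | h0
    · exact hx₁ (abs_eq_zero.mp h0)
    · norm_num at h0
  -- the equation with `x + 5` as variable
  have h' : y ^ 2 = (x + 5) * ((x + 5) - 45) * ((x + 5) + 35) := by rw [h]; ring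
  rcases lt_or_gt_of_ne hx₁ with hneg | hpos
  · rw [abs_of_neg hneg] at hu
    rcases hu with hu | hu | hu | hu
    · rw [show x + 5 = -3 * u ^ 2 by linarith] at h'
      refine not_sq_of_quartic 3 3 Nat.prime_three rfl _ sq_mem_mod9 (α := 1) (β := 15) (γ := -3)
        (δ := 35) (by decide) (u := u) (W := y / (3 * u)) ?_
      push_cast
      field_simp
      linear_combination h'
    · rw [show x + 5 = -15 * u ^ 2 by linarith] at h'
      refine not_sq_of_quartic 3 3 Nat.prime_three rfl _ sq_mem_mod9 (α := 1) (β := 3) (γ := -15)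
        (δ := 35) (by decide) (u := u) (W := y / (15 * u)) ?_
      push_cast
      field_simp
      linear_combination h'
    · rw [show x + 5 = -21 * u ^ 2 by linarith] at h'
      refine not_sq_of_quartic 2 8 Nat.prime_two rfl _ sq_mem_mod16 (α := 441) (β := 945)
        (γ := -21) (δ := 35) (by decide) (u := u) (W := y / u) ?_
      push_cast
      field_simp
      linear_combination h'
    · rw [show x + 5 = -105 * u ^ 2 by linarith] at h'
      refine not_sq_of_quartic 2 8 Nat.prime_two rfl _ sq_mem_mod16 (α := 11025) (β := 4725)
        (γ := -105) (δ := 35) (by decide) (u := u) (W := y / u) ?_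
      push_cast
      field_simp
      linear_combination h'
  · rw [abs_of_pos hpos] at hu
    rcases hu with hu | hu | hu | hu
    · rw [show x + 5 = 3 * u ^ 2 by linarith] at h'
      refine not_sq_of_quartic 2 8 Nat.prime_two rfl _ sq_mem_mod16 (α := 9) (β := -135) (γ := 3)
        (δ := 35) (by decide) (u := u) (W := y / u) ?_
      push_cast
      field_simp
      linear_combination h'
    · rw [show x + 5 = 15 * u ^ 2 by linarith] at h'
      refine not_sq_of_quartic 2 8 Nat.prime_two rfl _ sq_mem_mod16 (α := 225) (β := -675)
        (γ := 15) (δ := 35) (by decide) (u := u) (W := y / u) ?_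
      push_cast
      field_simp
      linear_combination h'
    · rw [show x + 5 = 21 * u ^ 2 by linarith] at h'
      refine not_sq_of_quartic 3 3 Nat.prime_three rfl _ sq_mem_mod9 (α := 49) (β := -105)
        (γ := 21) (δ := 35) (by decide) (u := u) (W := y / (3 * u)) ?_
      push_cast
      field_simp
      linear_combination h'
    · rw [show x + 5 = 105 * u ^ 2 by linarith] at h'
      refine not_sq_of_quartic 3 3 Nat.prime_three rfl _ sq_mem_mod9 (α := 49) (β := -21)
        (γ := 105) (δ := 35) (by decide) (u := u) (W := y / (15 * u)) ?_
      push_cast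
      field_simp
      linear_combination h'

/-! ### The arithmetic core -/

/-- **The `2`-descent on `T₅₂₅`, arithmetic core** (Silverman, *AEC*, Example X.1.5 carried out for
`y² = (x + 5)(x − 40)(x + 40)`, `S = {2, 3, 5, 7, ∞}`): for rationals with `y ≠ 0` there are
non-zero rationals `u, w` with `(x + 5, x − 40) ∈ {(u², w²), (5u², w²), (−7u², −5w²), (−35u², −5w²)}`.
Proof: `ord_3(x + 5)`, `ord_3(x − 40)` are even (`even_padicValRat_three`, `parities`), so
`|x + 5| ∈ {1, 5, 7, 35}·u²`, `|x − 40| ∈ {1, 2, 5, 10}·w²` (`exists_abs_eq_sq_or₂`); `x + 40 > 0` and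
`x + 5`, `x − 40` have the same sign (`y² > 0`); ten local computations (`not_sq_of_quartic` modulo
`16` or `7`) exclude `x + 5 ∈ {7, 35, −1, −5}·u²` and `x − 40 ∈ {2, 5, 10, −1, −2, −10}·w²`.
[cite: SilvermanAEC2009, Example X.1.5 (method)] -/
theorem exists_sq_of_sq_eq {x y : ℚ} (hy : y ≠ 0)
    (h : y ^ 2 = x ^ 3 + 5 * x ^ 2 - 1600 * x - 8000) :
    ∃ u w : ℚ, u ≠ 0 ∧ w ≠ 0 ∧
      (((x + 5 = u ^ 2 ∨ x + 5 = 5 * u ^ 2) ∧ x - 40 = w ^ 2) ∨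
        ((x + 5 = -7 * u ^ 2 ∨ x + 5 = -35 * u ^ 2) ∧ x - 40 = -5 * w ^ 2)) := by
  obtain ⟨hx₁, hx₂, hx₃, P₁, P₂, hlink⟩ := parities hy h
  have hev₁ := even_padicValRat_three hy h
  have hev₂ := hlink.mp hev₁
  haveI : Fact (Nat.Prime 5) := ⟨Nat.prime_five⟩
  haveI : Fact (Nat.Prime 7) := ⟨by decide⟩
  haveI : Fact (Nat.Prime 2) := ⟨Nat.prime_two⟩
  have hfac : y ^ 2 = (x + 5) * (x - 40) * (x + 40) := by rw [h]; ring
  -- the square classes of `x + 5` away from `{5, 7}` and of `x - 40` away from `{2, 5}`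
  obtain ⟨u, hu⟩ := exists_abs_eq_sq_or₂ hx₁ 5 7 fun p hp hp5 hp7 => by
    by_cases hp3 : p = 3
    · subst hp3; exact hev₁
    · exact P₁ p hp hp3 hp5 hp7
  push_cast at hu
  have hu0 : u ≠ 0 := by
    rintro rfl
    have : |x + 5| = 0 := by rcases hu with hu | hu | hu | hu <;> rw [hu] <;> ring
    exact hx₁ (abs_eq_zero.mp this)
  obtain ⟨w, hw⟩ := exists_abs_eq_sq_or₂ hx₂ 2 5 fun p hp hp2 hp5 => by
    by_cases hp3 : p = 3
    · subst hp3; exact hev₂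
    · exact P₂ p hp hp2 hp3 hp5
  push_cast at hw
  have hw0 : w ≠ 0 := by
    rintro rfl
    have : |x - 40| = 0 := by rcases hw with hw | hw | hw | hw <;> rw [hw] <;> ring
    exact hx₂ (abs_eq_zero.mp this)
  -- signs: `x + 40 > 0`, and `x + 5`, `x - 40` have the same sign
  have hprod : 0 < (x + 5) * (x - 40) * (x + 40) := by rw [← hfac]; positivity
  -- the equation in the two shapes used by the local computations
  have h' : y ^ 2 = (x + 5) * ((x + 5) - 45) * ((x + 5) + 35) := by rw [h]; ring
  have h'' : y ^ 2 = (x - 40) * ((x - 40) + 45) * ((x - 40) + 80) := by rw [h]; ring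
  refine ⟨u, w, hu0, hw0, ?_⟩
  rcases lt_or_gt_of_ne hx₂ with hneg | hpos
  · -- `x - 40 < 0`, hence `x + 5 < 0` (and `x + 40 > 0`)
    have hneg₁ : x + 5 < 0 := by
      by_contra hle
      push Not at hle
      have hpos₁ : 0 < x + 5 := lt_of_le_of_ne hle (Ne.symm hx₁)
      have hpos₃ : 0 < x + 40 := by linarith
      nlinarith [mul_pos hpos₁ hpos₃, mul_neg_of_pos_of_neg (mul_pos hpos₁ hpos₃) hneg]
    rw [abs_of_neg hneg₁] at hu
    rw [abs_of_neg hneg] at hw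
    refine Or.inr ⟨?_, ?_⟩
    · rcases hu with hu | hu | hu | hu
      · exfalso
        rw [show x + 5 = -u ^ 2 by linarith] at h'
        refine not_sq_of_quartic 2 8 Nat.prime_two rfl _ sq_mem_mod16 (α := 1) (β := 45) (γ := -1)
          (δ := 35) (by decide) (u := u) (W := y / u) ?_
        push_cast
        field_simp
        linear_combination h'
      · exfalso
        rw [show x + 5 = -5 * u ^ 2 by linarith] at h'
        refine not_sq_of_quartic 2 8 Nat.prime_two rfl _ sq_mem_mod16 (α := 25) (β := 225)
          (γ := -5) (δ := 35) (by decide) (u := u) (W := y / u) ?_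
        push_cast
        field_simp
        linear_combination h'
      · exact Or.inl (by linarith)
      · exact Or.inr (by linarith)
    · rcases hw with hw | hw | hw | hw
      · exfalso
        rw [show x - 40 = -w ^ 2 by linarith] at h''
        refine not_sq_of_quartic 7 1 (by decide) rfl _ sq_mem_mod7 (α := 1) (β := -45) (γ := -1)
          (δ := 80) (by decide) (u := w) (W := y / w) ?_
        push_cast
        field_simp
        linear_combination h''
      · exfalso
        rw [show x - 40 = -2 * w ^ 2 by linarith] at h''
        refine not_sq_of_quartic 7 1 (by decide) rfl _ sq_mem_mod7 (α := 4) (β := -90) (γ := -2)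
          (δ := 80) (by decide) (u := w) (W := y / w) ?_
        push_cast
        field_simp
        linear_combination h''
      · linarith
      · exfalso
        rw [show x - 40 = -10 * w ^ 2 by linarith] at h''
        refine not_sq_of_quartic 2 8 Nat.prime_two rfl _ sq_mem_mod16 (α := -10) (β := 45)
          (γ := 1) (δ := -8) (by decide) (u := w) (W := y / (10 * w)) ?_
        push_cast
        field_simp
        linear_combination h''
  · -- `x - 40 > 0`, hence `x + 5 > 0`
    have hpos₁ : 0 < x + 5 := by linarith
    rw [abs_of_pos hpos₁] at hu
    rw [abs_of_pos hpos] at hw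
    refine Or.inl ⟨?_, ?_⟩
    · rcases hu with hu | hu | hu | hu
      · exact Or.inl hu
      · exact Or.inr hu
      · exfalso
        rw [hu] at h'
        refine not_sq_of_quartic 2 8 Nat.prime_two rfl _ sq_mem_mod16 (α := 49) (β := -315)
          (γ := 7) (δ := 35) (by decide) (u := u) (W := y / u) ?_
        push_cast
        field_simp
        linear_combination h'
      · exfalso
        rw [show x + 5 = 35 * u ^ 2 by linarith] at h'
        refine not_sq_of_quartic 2 8 Nat.prime_two rfl _ sq_mem_mod16 (α := 1225) (β := -1575)
          (γ := 35) (δ := 35) (by decide) (u := u) (W := y / u) ?_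
        push_cast
        field_simp
        linear_combination h'
    · rcases hw with hw | hw | hw | hw
      · exact hw
      · exfalso
        rw [hw] at h''
        refine not_sq_of_quartic 2 8 Nat.prime_two rfl _ sq_mem_mod16 (α := 2) (β := 45) (γ := 1)
          (δ := 40) (by decide) (u := w) (W := y / (2 * w)) ?_
        push_cast
        field_simp
        linear_combination h''
      · exfalso
        rw [hw] at h''
        refine not_sq_of_quartic 7 1 (by decide) rfl _ sq_mem_mod7 (α := 25) (β := 225) (γ := 5)
          (δ := 80) (by decide) (u := w) (W := y / w) ?_
        push_cast
        field_simp
        linear_combination h''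
      · exfalso
        rw [show x - 40 = 10 * w ^ 2 by linarith] at h''
        refine not_sq_of_quartic 7 1 (by decide) rfl _ sq_mem_mod7 (α := 100) (β := 450)
          (γ := 10) (δ := 80) (by decide) (u := w) (W := y / w) ?_
        push_cast
        field_simp
        linear_combination h''

end Twist525

end Summit.Langlands.Langlands.Theorems.SqrtFiveQuarticCovers

end
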